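import Summits.CriticalPhenomena.SAWScalingLimit.Theses.SAWReversalUpgrade
import Summits.CriticalPhenomena.SAWScalingLimit.Theorems.SAWDevelopingMapHexTightLawPerturbation
import HarnessLib

/-!
# `LawTransfer` (stmt-CriticalPhenomena-18010, route `SAWReversalUpgrade`, support)

Landing target:
`Summits/CriticalPhenomena/SAWScalingLimit/Theorems/SAWReversalUpgradeLawTransfer.lean`
(`--workitem stmt-CriticalPhenomena-18010`).

**Theorem** (`lawTransfer_proof`, the route decl verbatim): Slutsky / "converging together" on
`CurveClass ℂ` for convergence in law to chordal SLE_κ along the mesh filter `𝓝[>] 0`. If `X δ → SLE_κ`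
in law in `(D; a, b)` (`ConvergesInLawToSLE κ D X P`), the laws `P δ` are eventually probability
measures, `Y δ` is eventually a.e.-measurable and `dist (X δ) (Y δ) → 0` in probability in the form
`(P δ {ε ≤ dist (X δ) (Y δ)}).toReal → 0` for every `ε > 0`, then `Y δ → SLE_κ` in law.

**Proof.** This is the tree's accepted perturbation lemma
`Summit.CriticalPhenomena.SAWScalingLimit.Theorems.HexTight.ReversibleDriving.stub_lawPerturbation`
(Billingsley, *Convergence of probability measures* (1999), Thm 3.1; bounded-Lipschitz reduction via
Mathlib's portmanteau criterion), whose closeness hypothesis is `P δ {ε < dist (X δ) (Y δ)} → 0` in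
`ℝ≥0∞`. The bridge: eventually `P δ` is a probability measure, so the `ℝ≥0∞`-mass of `{ε ≤ dist}` is
`ENNReal.ofReal` of its `toReal` and tends to `0` (`ENNReal.tendsto_ofReal`); `{ε < dist} ⊆ {ε ≤ dist}`
and a squeeze finish.

References: P. Billingsley, *Convergence of probability measures* (2nd ed., 1999), Thm 3.1 [Billingsley1999];
G. F. Lawler, *Conformally invariant processes in the plane* (2005), §6.3 [Lawler2005]. [folklore]
-/

noncomputable section

open scoped ENNReal NNReal Topology
open MeasureTheory Filter Set
open Literature.Probability.RandomPlanarGeometry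

namespace Summit.CriticalPhenomena.SAWScalingLimit.Theorems

/-- From `toReal`-convergence to `ℝ≥0∞`-convergence of the masses of the sets `{ε ≤ dist (X δ) (Y δ)}`,
and then of the smaller sets `{ε < dist (X δ) (Y δ)}`, for eventually-finite (here: eventually
probability) laws along a filter. Billingsley (1999), Thm 3.1 (bookkeeping). [folklore] -/
theorem tendsto_measure_lt_dist_of_tendsto_toReal {ι : Type*} {l : Filter ι} {Ω : ι → Type*}
    [∀ i, MeasurableSpace (Ω i)] {E : Type*} [PseudoMetricSpace E] {X Y : ∀ i, Ω i → E}
    {P : ∀ i, Measure (Ω i)} (hP : ∀ᶠ i in l, IsProbabilityMeasure (P i)) {ε : ℝ}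
    (h : Tendsto (fun i => ((P i) {ω | ε ≤ dist (X i ω) (Y i ω)}).toReal) l (𝓝 0)) :
    Tendsto (fun i => (P i) {ω | ε < dist (X i ω) (Y i ω)}) l (𝓝 0) := by
  have h1 : Tendsto (fun i => ENNReal.ofReal ((P i) {ω | ε ≤ dist (X i ω) (Y i ω)}).toReal)
      l (𝓝 0) := by
    simpa only [ENNReal.ofReal_zero] using ENNReal.tendsto_ofReal h
  have h2 : Tendsto (fun i => (P i) {ω | ε ≤ dist (X i ω) (Y i ω)}) l (𝓝 0) := by
    refine h1.congr' ?_
    filter_upwards [hP] with i hPi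
    exact ENNReal.ofReal_toReal (measure_ne_top _ _)
  refine tendsto_of_tendsto_of_tendsto_of_le_of_le' tendsto_const_nhds h2
    (Eventually.of_forall fun _ => zero_le) (Eventually.of_forall fun i => ?_)
  exact measure_mono fun ω (hω : ε < dist (X i ω) (Y i ω)) => hω.le

/-- **`LawTransfer`** (route `SAWReversalUpgrade`, stmt-CriticalPhenomena-18010): Slutsky on
`CurveClass ℂ` — convergence in law to chordal SLE_κ passes from `X δ` to `Y δ` when
`dist (X δ) (Y δ) → 0` in `P δ`-probability (`P δ` eventually probability, `Y δ` eventually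
a.e.-measurable). Reduced to the tree's `HexTight.ReversibleDriving.stub_lawPerturbation` by
`tendsto_measure_lt_dist_of_tendsto_toReal`. Billingsley (1999), Thm 3.1. [folklore] -/
theorem lawTransfer_proof :
    Summit.CriticalPhenomena.SAWScalingLimit.Theses.SAWReversalUpgrade.LawTransfer := by
  unfold Summit.CriticalPhenomena.SAWScalingLimit.Theses.SAWReversalUpgrade.LawTransfer
  intro κ D Ω _ X Y P hP hY hXY hX
  exact HexTight.ReversibleDriving.stub_lawPerturbation κ D Ω X Y P hP hY
    (fun ε hε => tendsto_measure_lt_dist_of_tendsto_toReal hP (hXY ε hε)) hX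

end Summit.CriticalPhenomena.SAWScalingLimit.Theorems

end
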